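import Summits.NavierStokesRegularity.NavierStokesRegularity.Theorems.SqueezeCycleSingularProfileOfNontrivialTypeIBound
import Literature.Analysis.FluidPDE.LocalTypeIScaling
import Literature.Analysis.FluidPDE.ClassicalSuitable
import Literature.Analysis.FluidPDE.SuitableWeakPressure
import HarnessLib

/-!
# Route FrozenSignCascade · crux `BoundedEnvelopeContinuation` — stub Z5, part 1:
# the unit-scale estimates behind `𝐈 < ∞` for a Morrey-bounded ancient solution

Helper file for the crux item stmt-NavierStokesRegularity-10579 (`BoundedEnvelopeContinuation`,
conjunct (B) of route `FrozenSignCascade`); lands `--supports` that item (stub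
`stub_liouvilleMorreyOfNoLocalTypeI` of the registered line, reshape r3: `¬ LocalTypeISingularityExists`
⇒ (L_M)). The stub needs `𝐈((EuclideanSpace ℝ (Fin 3)) × ℝ₋) < ∞` — UNIFORM bounds for Albritton–Barker's `A, C, D, E`
over all parabolic balls of the past — for a classical solution `(v, P)` of the unforced
unit-viscosity system on `(-∞,0)`, bounded by `V`, whose slices obey the scale-invariant Morrey
bound `∫_{B_r(y)} ‖v t‖² ≤ M r` at ALL radii. This file proves the two estimates at the UNIT scale
and the covariance of the setting under the Navier–Stokes zoom; the sequel
(`…MorreyTypeIBound.lean`) transfers them to every ball and runs the bootstrap.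

* `cknAEss_le_of_morrey` — `A ≤ M` on every past ball (`esssup ≤ sup`).
* `cknC_one_le_of_bound` — the a priori bound `C(Q(0,1)) ≤ V M` (`|v|³ ≤ V|v|²`).
* `zoom_setting` — the zoom `c v(t₀ + c²s, x₀ + cy)` about a past point is again classical on
  `(-∞,0)`, with the SAME Morrey constant and the bound `cV`.
* `unit_localEnergy` — the local energy inequality `A(½) + E(½) ≲ C(1), D(1)`
  (`Seregin2020.localEnergyBound_top`) with the MEAN-FREE `D`: the pressure gauged by its
  unit-ball mean is again suitable (`IsSuitableWeakSolutionOn.sub_pressure`).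
* `unit_cknDOsc_le` — `D(Q(0,1)) ≤ 9K₁ C(Q(0,3)) + K₂ M^{3/2}` with NO iteration: any classical
  pressure is the Riesz pressure `Q[v(t)]` up to a function of time (Tao's probe argument in the
  Morrey class, `SingularProfile.pressure_sub_pressurePotential_eq_morrey`), whose unit-ball
  oscillation is bounded by Calderón–Zygmund near the ball and by the Morrey far field
  (`SingularProfile.exists_slice_oscillation_bound`).

## References

* D. Albritton, T. Barker, J. Math. Fluid Mech. 21 (2019) = arXiv:1811.00502, Thm 1.1, §3,
  Lemma 2.6 and Rem. 3.2. [AlbrittonBarker2019]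
* G. Seregin, arXiv:math/0607537 = J. Math. Sci. 143 (2007), §2, Lemma 2.1 (estimates between
  the scaled energies). [Seregin2006]
* T. Tao, Anal. PDE 6 (2013), §4, proof of Lemma 4.1 (i) (pressure identification). [Tao2011]
* G. Koch, N. Nadirashvili, G. Seregin, V. Šverák, Acta Math. 203 (2009), §1.
  [KochNadirashviliSereginSverak2009]
-/

noncomputable section

set_option linter.dupNamespace false -- nested layout Summit.<S>.<Sub>, Sub = S (D-0017)
-- nested operator types `(EuclideanSpace ℝ (Fin 3)) →L[ℝ] (EuclideanSpace ℝ (Fin 3)) →L[ℝ] (EuclideanSpace ℝ (Fin 3)) →L[ℝ] ℝ` (pressure kernels)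
set_option maxSynthPendingDepth 3

open Set MeasureTheory Filter Topology Metric Function
open scoped ENNReal NNReal
open Literature.Analysis Literature.Analysis.FluidPDE
open Summit.NavierStokesRegularity.NavierStokesRegularity.Theorems.SingularProfile

namespace Summit.NavierStokesRegularity.NavierStokesRegularity.Theorems.BoundedEnvelope

/-! ### Elementary facts -/

/-- A parabolic ball with top time `≤ 0` lies in the open past `(-∞,0) × (EuclideanSpace ℝ (Fin 3))`. [folklore] -/
theorem parabolicCylinder_subset_past {r : ℝ} {z : ℝ × (EuclideanSpace ℝ (Fin 3))} (hz : z.1 ≤ 0) :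
    parabolicCylinder r z ⊆ Iio (0 : ℝ) ×ˢ (univ : Set (EuclideanSpace ℝ (Fin 3))) := by
  intro w hw
  rw [mem_parabolicCylinder] at hw
  exact ⟨lt_of_lt_of_le hw.1.2 hz, mem_univ _⟩

/-- The zoom about `z` with factor `r` maps the unit ball's centre to `z`. [folklore] -/
theorem stAffine_sq_zero (r : ℝ) (z : ℝ × (EuclideanSpace ℝ (Fin 3))) : stAffine (r ^ 2) r z.1 z.2 (0 : ℝ × (EuclideanSpace ℝ (Fin 3))) = z := by
  ext <;> simp [stAffine_fst, stAffine_snd]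

/-- **`A ≤ M` on every past ball from the Morrey bound** (`esssup ≤ sup`). [folklore] -/
theorem cknAEss_le_of_morrey {v : ℝ → (EuclideanSpace ℝ (Fin 3)) → (EuclideanSpace ℝ (Fin 3))} {M : ℝ}
    (hcont : ∀ t < 0, Continuous (v t))
    (hMor : ∀ t < 0, ∀ (y : (EuclideanSpace ℝ (Fin 3))) (r : ℝ), 0 < r → ∫ x in ball y r, ‖v t x‖ ^ 2 ≤ M * r)
    {r : ℝ} (hr : 0 < r) {z : ℝ × (EuclideanSpace ℝ (Fin 3))} (hz : z.1 ≤ 0) :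
    cknAEss r z v ≤ ENNReal.ofReal M := by
  unfold cknAEss
  refine essSup_le_of_ae_le _ ?_
  filter_upwards [ae_restrict_mem measurableSet_Ioo] with t ht
  have ht0 : t < 0 := lt_of_lt_of_le ht.2 hz
  rw [lintegral_ball_enorm_sq_eq (hcont t ht0) z.2 r]
  have hr0 : ENNReal.ofReal r ≠ 0 := (ENNReal.ofReal_pos.2 hr).ne'
  calc (ENNReal.ofReal r)⁻¹ * ENNReal.ofReal (∫ x in ball z.2 r, ‖v t x‖ ^ 2)
      ≤ (ENNReal.ofReal r)⁻¹ * ENNReal.ofReal (M * r) := by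
        gcongr
        exact hMor t ht0 z.2 r hr
    _ = ENNReal.ofReal M := by
        rw [ENNReal.ofReal_mul' hr.le, mul_comm (ENNReal.ofReal M), ← mul_assoc,
          ENNReal.inv_mul_cancel hr0 ENNReal.ofReal_ne_top, one_mul]

/-- **A priori linear growth of `C` at the unit scale**: for a field bounded by `V` with the
Morrey bound `M`, `C(Q(0,1)) ≤ V M` (`|v|³ ≤ V |v|²`, Tonelli). [folklore] -/
theorem cknC_one_le_of_bound {w : ℝ → (EuclideanSpace ℝ (Fin 3)) → (EuclideanSpace ℝ (Fin 3))} {M V : ℝ} (hV : 0 ≤ V)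
    (hcont : ∀ t < 0, Continuous (w t))
    (hMor : ∀ t < 0, ∀ (y : (EuclideanSpace ℝ (Fin 3))) (r : ℝ), 0 < r → ∫ x in ball y r, ‖w t x‖ ^ 2 ≤ M * r)
    (hbd : ∀ t < 0, ∀ x, ‖w t x‖ ≤ V) :
    cknC 1 (0 : ℝ × (EuclideanSpace ℝ (Fin 3))) w ≤ ENNReal.ofReal (V * M) := by
  unfold cknC
  rw [ENNReal.ofReal_one, one_pow, inv_one, one_mul, parabolicCylinder_one_zero,
    Measure.volume_eq_prod, ← Measure.prod_restrict]
  refine (lintegral_prod_le _).trans ?_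
  -- slice bound
  have hslice : ∀ t ∈ Ioo (-1 : ℝ) 0,
      ∫⁻ x in ball (0 : (EuclideanSpace ℝ (Fin 3))) 1, ‖w (t, x).1 (t, x).2‖ₑ ^ (3 : ℕ) ≤ ENNReal.ofReal (V * M) := by
    intro t ht
    have ht0 : t < 0 := ht.2
    have hpt : ∀ x, ‖w t x‖ₑ ^ (3 : ℕ) ≤ ENNReal.ofReal V * ‖w t x‖ₑ ^ 2 := by
      intro x
      rw [pow_succ, mul_comm]
      gcongr
      rw [← ofReal_norm]
      exact ENNReal.ofReal_le_ofReal (hbd t ht0 x)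
    calc ∫⁻ x in ball (0 : (EuclideanSpace ℝ (Fin 3))) 1, ‖w (t, x).1 (t, x).2‖ₑ ^ (3 : ℕ)
        ≤ ∫⁻ x in ball (0 : (EuclideanSpace ℝ (Fin 3))) 1, ENNReal.ofReal V * ‖w t x‖ₑ ^ 2 := lintegral_mono fun x => hpt x
      _ = ENNReal.ofReal V * ENNReal.ofReal (∫ x in ball (0 : (EuclideanSpace ℝ (Fin 3))) 1, ‖w t x‖ ^ 2) := by
          rw [lintegral_const_mul' _ _ ENNReal.ofReal_ne_top, lintegral_ball_enorm_sq_eq (hcont t ht0)]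
      _ ≤ ENNReal.ofReal V * ENNReal.ofReal (M * 1) := by
          gcongr
          exact hMor t ht0 0 1 one_pos
      _ = ENNReal.ofReal (V * M) := by rw [mul_one, ← ENNReal.ofReal_mul hV]
  calc ∫⁻ t in Ioo (-1 : ℝ) 0, ∫⁻ x in ball (0 : (EuclideanSpace ℝ (Fin 3))) 1, ‖w (t, x).1 (t, x).2‖ₑ ^ (3 : ℕ)
      ≤ ∫⁻ t in Ioo (-1 : ℝ) 0, ENNReal.ofReal (V * M) := setLIntegral_mono' measurableSet_Ioo hslice
    _ = ENNReal.ofReal (V * M) := by rw [setLIntegral_const, Real.volume_Ioo]; norm_num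

/-- **The Navier–Stokes zoom about a past point preserves the setting**: for a classical solution
`(v, P)` of the unforced unit-viscosity system on `(-∞,0)`, bounded by `V`, with the Morrey bound
`M` at all radii, and `c > 0`, `t₀ ≤ 0`, the zoom `(s,y) ↦ c v(t₀ + c²s, x₀ + cy)` with pressure
`c² P ∘ Φ` is again classical on `(-∞,0)`, has the SAME Morrey constant and is bounded by `cV`.
[cite: KochNadirashviliSereginSverak2009, §1 (1.2) (arXiv:0709.3599 p. 2)] -/
theorem zoom_setting {v : ℝ → (EuclideanSpace ℝ (Fin 3)) → (EuclideanSpace ℝ (Fin 3))} {P : ℝ → (EuclideanSpace ℝ (Fin 3)) → ℝ} {M V : ℝ}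
    (hcl : IsClassicalNSSolutionOn (Iio 0) 1 0 v P)
    (hMor : ∀ t < 0, ∀ (y : (EuclideanSpace ℝ (Fin 3))) (r : ℝ), 0 < r → ∫ x in ball y r, ‖v t x‖ ^ 2 ≤ M * r)
    (hbd : ∀ t < 0, ∀ x, ‖v t x‖ ≤ V)
    {c : ℝ} (hc : 0 < c) {t₀ : ℝ} (ht₀ : t₀ ≤ 0) (x₀ : (EuclideanSpace ℝ (Fin 3))) :
    IsClassicalNSSolutionOn (Iio 0) 1 0 (c • stPull (c ^ 2) c t₀ x₀ v)
        (c ^ 2 • stPull (c ^ 2) c t₀ x₀ P) ∧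
      (∀ s < 0, ∀ (y : (EuclideanSpace ℝ (Fin 3))) (r : ℝ), 0 < r →
        ∫ y' in ball y r, ‖(c • stPull (c ^ 2) c t₀ x₀ v) s y'‖ ^ 2 ≤ M * r) ∧
      (∀ s < 0, ∀ y, ‖(c • stPull (c ^ 2) c t₀ x₀ v) s y‖ ≤ c * V) := by
  have hneg : ∀ {s : ℝ}, s < 0 → t₀ + c ^ 2 * s < 0 := fun {s} hs => by
    nlinarith [mul_pos (pow_pos hc 2) (neg_pos.2 hs)]
  refine ⟨?_, ?_, ?_⟩
  · have h := hcl.nsRescale_translate_zero hc t₀ x₀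
    exact h.mono (fun s (hs : s < 0) => show t₀ + c ^ 2 * s < 0 from hneg hs) (uniqueDiffOn_Iio 0)
  · intro s hs y r hr
    set δ : ℝ := -t₀ with hδ
    have e : c • stPull (c ^ 2) c t₀ x₀ v = c • stPull (c ^ 2) c 0 x₀ (fun s => v (s - δ)) := by
      congr 1
      funext s' y'
      simp only [stPull_apply, hδ]
      congr 1
      ring
    have key := scaledEnergy_zoom hc x₀ y (fun s => v (s - δ)) s hr
    rw [← e] at key
    have hs' : c ^ 2 * s - δ < 0 := by
      have := hneg hs
      rw [hδ]; linarith
    have hb := hMor (c ^ 2 * s - δ) hs' (x₀ + c • y) (c * r) (mul_pos hc hr)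
    have hcr : 0 < c * r := mul_pos hc hr
    have h2 : r⁻¹ * ∫ y' in ball y r, ‖(c • stPull (c ^ 2) c t₀ x₀ v) s y'‖ ^ 2 ≤ M := by
      rw [key]
      calc (c * r)⁻¹ * ∫ x in ball (x₀ + c • y) (c * r), ‖v (c ^ 2 * s - δ) x‖ ^ 2
          ≤ (c * r)⁻¹ * (M * (c * r)) :=
            mul_le_mul_of_nonneg_left hb (inv_nonneg.2 hcr.le)
        _ = M := by field_simp
    rwa [inv_mul_le_iff₀ hr, mul_comm] at h2
  · intro s hs y
    rw [smul_stPull_apply, norm_smul, Real.norm_of_nonneg hc.le]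
    exact mul_le_mul_of_nonneg_left (hbd _ (hneg hs) _) hc.le


/-! ### The unit-scale estimates -/

/-- **The local energy inequality at the unit scale** for a classical solution on `(-∞,0)`:
`A(Q(0,½)) + E(Q(0,½)) ≤ c₁ C(1)^{2/3} + c₂ C(1) + c₃ D(1)^{2/3} C(1)^{1/3}` with Albritton–Barker's
MEAN-FREE `D` (the pressure gauged by its unit-ball mean is again suitable,
`IsSuitableWeakSolutionOn.sub_pressure`, and its plain `D` is the mean-free one).
[cite: Seregin2006, §2 (2.1)–(2.6); Tsai1998, remark after Lemma 4.2] -/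
theorem unit_localEnergy {c₁ c₂ c₃ : ℝ≥0}
    (HT : ∀ (Q : TopologicalSpace.Opens (ℝ × (EuclideanSpace ℝ (Fin 3)))) (u : ℝ → (EuclideanSpace ℝ (Fin 3)) → (EuclideanSpace ℝ (Fin 3))) (p : ℝ → (EuclideanSpace ℝ (Fin 3)) → ℝ)
      (G : ℝ → (EuclideanSpace ℝ (Fin 3)) → (EuclideanSpace ℝ (Fin 3)) →L[ℝ] (EuclideanSpace ℝ (Fin 3))), IsSuitableWeakSolutionOn Q 1 0 u p →
      HasWeakSpatialGradientOn Q u G →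
      ∀ (z : ℝ × (EuclideanSpace ℝ (Fin 3))) (R : ℝ), 0 < R → parabolicCylinder R z ⊆ (Q : Set (ℝ × (EuclideanSpace ℝ (Fin 3)))) →
        cknAEss (R / 2) z u + cknE (R / 2) z G ≤
          c₁ * cknC R z u ^ (2 / 3 : ℝ) + c₂ * cknC R z u +
            c₃ * (cknD R z p ^ (2 / 3 : ℝ) * cknC R z u ^ (1 / 3 : ℝ)))
    {w : ℝ → (EuclideanSpace ℝ (Fin 3)) → (EuclideanSpace ℝ (Fin 3))} {q : ℝ → (EuclideanSpace ℝ (Fin 3)) → ℝ} (hcl : IsClassicalNSSolutionOn (Iio 0) 1 0 w q) :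
    cknAEss (1 / 2) (0 : ℝ × (EuclideanSpace ℝ (Fin 3))) w + cknE (1 / 2) (0 : ℝ × (EuclideanSpace ℝ (Fin 3))) (fun s y => fderiv ℝ (w s) y) ≤
      c₁ * cknC 1 (0 : ℝ × (EuclideanSpace ℝ (Fin 3))) w ^ (2 / 3 : ℝ) + c₂ * cknC 1 (0 : ℝ × (EuclideanSpace ℝ (Fin 3))) w +
        c₃ * (cknDOsc 1 (0 : ℝ × (EuclideanSpace ℝ (Fin 3))) q ^ (2 / 3 : ℝ) * cknC 1 (0 : ℝ × (EuclideanSpace ℝ (Fin 3))) w ^ (1 / 3 : ℝ)) := by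
  have hQ : (((Literature.Analysis.FluidPDE.slab (EuclideanSpace ℝ (Fin 3)) (Set.Iio (0 : ℝ)) isOpen_Iio) : TopologicalSpace.Opens (ℝ × (EuclideanSpace ℝ (Fin 3)))) : Set (ℝ × (EuclideanSpace ℝ (Fin 3)))) ⊆ Iio (0 : ℝ) ×ˢ univ := by
    rw [coe_slab]
  -- the time gauge: the unit-ball mean of the pressure
  set m : ℝ → ℝ := fun t => ⨍ y in ball (0 : (EuclideanSpace ℝ (Fin 3))) 1, q t y with hm
  have hqc : ContinuousOn (uncurry q) (Iio (0 : ℝ) ×ˢ univ) := hcl.smooth_pressure.continuousOn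
  have hmc : ContinuousOn m (Iio 0) := continuousOn_ballMean hqc
  have hmc' : ContinuousOn (fun z : ℝ × (EuclideanSpace ℝ (Fin 3)) => m z.1) (Iio (0 : ℝ) ×ˢ (univ : Set (EuclideanSpace ℝ (Fin 3)))) :=
    hmc.comp continuous_fst.continuousOn fun z hz => hz.1
  have hsw0 : IsSuitableWeakSolutionOn (Literature.Analysis.FluidPDE.slab (EuclideanSpace ℝ (Fin 3)) (Set.Iio (0 : ℝ)) isOpen_Iio) 1 0 w q := by
    refine isSuitableWeakSolutionOn_of_contDiffOn isOpen_Iio hQ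
      (hcl.smooth_velocity.of_le (by norm_cast)) (hcl.smooth_pressure.of_le (by norm_cast))
      continuousOn_const (fun t ht x => ?_) hcl.divFree
    have hmom := hcl.momentum t ht x
    rwa [timeDerivWithin_apply, derivWithin_of_isOpen isOpen_Iio ht, ← timeDeriv_apply] at hmom
  have hsw : IsSuitableWeakSolutionOn (Literature.Analysis.FluidPDE.slab (EuclideanSpace ℝ (Fin 3)) (Set.Iio (0 : ℝ)) isOpen_Iio) 1 0 w (fun t x => q t x - m t) := by
    refine hsw0.sub_pressure ?_ ?_
    · rw [coe_slab]
      exact hmc'.locallyIntegrableOn (measurableSet_Iio.prod MeasurableSet.univ)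
    · intro K hK hKc
      rw [coe_slab] at hK
      obtain ⟨B, hB⟩ := hKc.exists_bound_of_continuousOn (hmc'.mono hK)
      calc ∫⁻ z in K, ‖m z.1‖ₑ ^ (3 / 2 : ℝ) ≤ ∫⁻ _ in K, ENNReal.ofReal B ^ (3 / 2 : ℝ) := by
            refine setLIntegral_mono' hKc.measurableSet fun z hz => ?_
            gcongr
            rw [← ofReal_norm]
            exact ENNReal.ofReal_le_ofReal (hB z hz)
        _ < ⊤ := by
            rw [setLIntegral_const]
            exact ENNReal.mul_lt_top
              (ENNReal.rpow_lt_top_of_nonneg (by norm_num) ENNReal.ofReal_ne_top) hKc.measure_lt_top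
  have hG : HasWeakSpatialGradientOn (Literature.Analysis.FluidPDE.slab (EuclideanSpace ℝ (Fin 3)) (Set.Iio (0 : ℝ)) isOpen_Iio) w fun t x => fderiv ℝ (w t) x :=
    hasWeakSpatialGradientOn_of_contDiffOn isOpen_Iio hQ (hcl.smooth_velocity.of_le (by norm_cast))
  have hsub : parabolicCylinder 1 (0 : ℝ × (EuclideanSpace ℝ (Fin 3))) ⊆
      (((Literature.Analysis.FluidPDE.slab (EuclideanSpace ℝ (Fin 3)) (Set.Iio (0 : ℝ)) isOpen_Iio) : TopologicalSpace.Opens (ℝ × (EuclideanSpace ℝ (Fin 3)))) : Set (ℝ × (EuclideanSpace ℝ (Fin 3)))) := by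
    rw [coe_slab]
    exact parabolicCylinder_subset_past le_rfl
  have key := HT (Literature.Analysis.FluidPDE.slab (EuclideanSpace ℝ (Fin 3)) (Set.Iio (0 : ℝ)) isOpen_Iio) w _ _ hsw hG 0 1 one_pos hsub
  have hD : cknD 1 (0 : ℝ × (EuclideanSpace ℝ (Fin 3))) (fun t x => q t x - m t) = cknDOsc 1 (0 : ℝ × (EuclideanSpace ℝ (Fin 3))) q := by
    simp only [cknD, cknDOsc, hm, Prod.snd_zero]
  rw [hD] at key
  exact key

/-- **The mean-free pressure quantity at the unit scale**: for a classical solution `(w, q)` on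
`(-∞,0)` with the Morrey bound `M` at all radii, `D(Q(0,1)) ≤ K₁ · 9 C(Q(0,3)) + K₂ M^{3/2}`:
on every slice `q(t) = Q[w(t)] + c(t)` (Tao's probe argument in the Morrey class), so the
mean-free quantity sees only the Riesz pressure `Q[w(t)]`, whose unit-ball oscillation is
`≤ K₁ ∫_{B(0,3)} |w(t)|³ + K₂ M^{3/2}`; integrate over `t ∈ (-1,0)` (Tonelli).
[cite: Tao2011, §4, proof of Lemma 4.1 (i); AlbrittonBarker2019, §3, Rem. 3.2] -/
theorem unit_cknDOsc_le {K₁ K₂ : ℝ≥0∞} (hK₁t : K₁ ≠ ⊤)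
    (hK : ∀ (u : (EuclideanSpace ℝ (Fin 3)) → (EuclideanSpace ℝ (Fin 3))) (A : ℝ), ContDiff ℝ 4 u →
      (∀ (x : (EuclideanSpace ℝ (Fin 3))) (r : ℝ), 1 ≤ r → ∫ y in ball x r, ‖u y‖ ^ 2 ≤ A * r) →
      ∫⁻ x in ball (0 : (EuclideanSpace ℝ (Fin 3))) 1,
          ‖pressurePotential u x - ⨍ y in ball (0 : (EuclideanSpace ℝ (Fin 3))) 1, pressurePotential u y‖ₑ ^ (3 / 2 : ℝ) ≤
        K₁ * (∫⁻ y in ball (0 : (EuclideanSpace ℝ (Fin 3))) 3, ‖u y‖ₑ ^ (3 : ℕ)) + K₂ * ENNReal.ofReal A ^ (3 / 2 : ℝ))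
    {w : ℝ → (EuclideanSpace ℝ (Fin 3)) → (EuclideanSpace ℝ (Fin 3))} {q : ℝ → (EuclideanSpace ℝ (Fin 3)) → ℝ} {M : ℝ} (hM : 0 ≤ M)
    (hcl : IsClassicalNSSolutionOn (Iio 0) 1 0 w q)
    (hMor : ∀ t < 0, ∀ (y : (EuclideanSpace ℝ (Fin 3))) (r : ℝ), 0 < r → ∫ x in ball y r, ‖w t x‖ ^ 2 ≤ M * r) :
    cknDOsc 1 (0 : ℝ × (EuclideanSpace ℝ (Fin 3))) q ≤
      K₁ * (ENNReal.ofReal 3 ^ 2 * cknC 3 (0 : ℝ × (EuclideanSpace ℝ (Fin 3))) w) + K₂ * ENNReal.ofReal M ^ (3 / 2 : ℝ) := by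
  -- pressure identification on every slice
  have hid : ∀ t < 0, ∀ x, q t x = pressurePotential (w t) x + (q t 0 - pressurePotential (w t) 0) := by
    intro t ht x
    set t₁ : ℝ := t - 1 with ht₁
    set T : ℝ := t / 2 - t₁ with hT
    have hT0 : 0 < T := by rw [hT, ht₁]; linarith
    have hsol' : IsClassicalNSSolutionOn (Icc 0 T) 1 0 (fun s => w (s + t₁)) (fun s => q (s + t₁)) := by
      have h := hcl.comp_add_right t₁
      refine h.mono (fun s hs => ?_) (uniqueDiffOn_Icc hT0)
      show s + t₁ < 0
      have := hs.2
      rw [hT] at this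
      linarith
    have hA : ∀ s ∈ Icc 0 T, ∀ (x : (EuclideanSpace ℝ (Fin 3))) (r : ℝ), 1 ≤ r →
        ∫ y in ball x r, ‖w (s + t₁) y‖ ^ 2 ≤ M * r := by
      intro s hs x r hr
      have hs0 : s + t₁ < 0 := by have := hs.2; rw [hT] at this; linarith
      exact hMor _ hs0 x r (by linarith)
    have key := pressure_sub_pressurePotential_eq_morrey zero_le_one hsol' hM hA
      (t := t - t₁) ⟨by rw [ht₁]; linarith, by rw [hT, ht₁]; linarith⟩ x
    simp only [sub_add_cancel] at key
    linarith
  have hqc : ContinuousOn (uncurry q) (Iio (0 : ℝ) ×ˢ univ) := hcl.smooth_pressure.continuousOn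
  set m : ℝ → ℝ := fun t => ⨍ y in ball (0 : (EuclideanSpace ℝ (Fin 3))) 1, q t y with hm
  have hmc : ContinuousOn m (Iio 0) := continuousOn_ballMean hqc
  unfold cknDOsc
  rw [ENNReal.ofReal_one, one_pow, inv_one, one_mul]
  simp only [Prod.snd_zero]
  have hF : AEMeasurable (fun w' : ℝ × (EuclideanSpace ℝ (Fin 3)) => ‖q w'.1 w'.2 - m w'.1‖ₑ ^ (3 / 2 : ℝ))
      (volume.restrict (parabolicCylinder 1 (0 : ℝ × (EuclideanSpace ℝ (Fin 3))))) := by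
    refine aemeasurable_parabolicCylinder_one_of_continuousOn ?_
    have hdiff : ContinuousOn (fun w' : ℝ × (EuclideanSpace ℝ (Fin 3)) => q w'.1 w'.2 - m w'.1) (Iio (0 : ℝ) ×ˢ univ) :=
      hqc.sub (hmc.comp continuous_fst.continuousOn fun w' hw' => hw'.1)
    exact ENNReal.continuous_rpow_const.comp_continuousOn (continuous_enorm.comp_continuousOn hdiff)
  rw [lintegral_parabolicCylinder_one_eq hF]
  -- the slice bound
  have hslice : ∀ t ∈ Ioo (-1 : ℝ) 0,
      ∫⁻ x in ball (0 : (EuclideanSpace ℝ (Fin 3))) 1, ‖q t x - m t‖ₑ ^ (3 / 2 : ℝ) ≤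
        K₁ * (∫⁻ y in ball (0 : (EuclideanSpace ℝ (Fin 3))) 3, ‖w t y‖ₑ ^ (3 : ℕ)) + K₂ * ENNReal.ofReal M ^ (3 / 2 : ℝ) := by
    intro t ht
    have ht0 : t < 0 := ht.2
    have hv4 : ContDiff ℝ 4 (w t) := contDiff_infty.1 (hcl.contDiff_velocity ht0) 4
    have hA : ∀ (x : (EuclideanSpace ℝ (Fin 3))) (r : ℝ), 1 ≤ r → ∫ y in ball x r, ‖w t y‖ ^ 2 ≤ M * r :=
      fun x r hr => hMor t ht0 x r (by linarith)
    set Qp := pressurePotential (w t) with hQp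
    obtain ⟨c, hc⟩ : ∃ c : ℝ, ∀ x, q t x = Qp x + c := ⟨q t 0 - Qp 0, fun x => hid t ht0 x⟩
    have hQc : Continuous Qp := (contDiff_pressurePotential_morrey hv4 hA).continuous
    have hV0 : volume (ball (0 : (EuclideanSpace ℝ (Fin 3))) 1) ≠ 0 := (measure_ball_pos volume _ one_pos).ne'
    have hVt : volume (ball (0 : (EuclideanSpace ℝ (Fin 3))) 1) ≠ ⊤ := measure_ball_lt_top.ne
    have hmean : m t = (⨍ y in ball (0 : (EuclideanSpace ℝ (Fin 3))) 1, Qp y) + c := by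
      have hQi : IntegrableOn Qp (ball (0 : (EuclideanSpace ℝ (Fin 3))) 1) volume :=
        (hQc.continuousOn.integrableOn_compact (isCompact_closedBall 0 1)).mono_set
          ball_subset_closedBall
      have e : (fun y => q t y) = fun y => Qp y + c := funext hc
      rw [hm]
      dsimp only
      rw [e, setAverage_eq, setAverage_eq, integral_add hQi (integrableOn_const hVt),
        setIntegral_const, smul_eq_mul, smul_eq_mul, smul_eq_mul, mul_add]
      have hreal : volume.real (ball (0 : (EuclideanSpace ℝ (Fin 3))) 1) ≠ 0 := (ENNReal.toReal_pos hV0 hVt).ne'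
      congr 1
      field_simp
    have hptw : ∀ x, ‖q t x - m t‖ₑ ^ (3 / 2 : ℝ) =
        ‖Qp x - ⨍ y in ball (0 : (EuclideanSpace ℝ (Fin 3))) 1, Qp y‖ₑ ^ (3 / 2 : ℝ) := fun x => by
      rw [hc x, hmean]
      congr 2
      ring
    simp only [hptw]
    exact hK (w t) M hv4 hA
  -- `∫_{(-1,0)} ∫_{B(0,3)} |w|³ ≤ 9 C(Q(0,3))`
  have htime : ∫⁻ t in Ioo (-1 : ℝ) 0, ∫⁻ y in ball (0 : (EuclideanSpace ℝ (Fin 3))) 3, ‖w t y‖ₑ ^ (3 : ℕ) ≤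
      ENNReal.ofReal 3 ^ 2 * cknC 3 (0 : ℝ × (EuclideanSpace ℝ (Fin 3))) w := by
    have hwc : ContinuousOn (fun w' : ℝ × (EuclideanSpace ℝ (Fin 3)) => ‖w w'.1 w'.2‖ₑ ^ (3 : ℕ)) (Iio (0 : ℝ) ×ˢ univ) :=
      (ENNReal.continuous_pow 3).comp_continuousOn
        (continuous_enorm.comp_continuousOn hcl.smooth_velocity.continuousOn)
    have hsub : Ioo (-1 : ℝ) 0 ×ˢ ball (0 : (EuclideanSpace ℝ (Fin 3))) 3 ⊆ Iio (0 : ℝ) ×ˢ univ :=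
      prod_mono (fun t ht => ht.2) (subset_univ _)
    have hmeas : AEMeasurable (fun w' : ℝ × (EuclideanSpace ℝ (Fin 3)) => ‖w w'.1 w'.2‖ₑ ^ (3 : ℕ))
        ((volume.restrict (Ioo (-1 : ℝ) 0)).prod (volume.restrict (ball (0 : (EuclideanSpace ℝ (Fin 3))) 3))) := by
      rw [Measure.prod_restrict, ← Measure.volume_eq_prod]
      exact (hwc.mono hsub).aemeasurable (measurableSet_Ioo.prod measurableSet_ball)
    have e1 : ∫⁻ w' in Ioo (-1 : ℝ) 0 ×ˢ ball (0 : (EuclideanSpace ℝ (Fin 3))) 3, ‖w w'.1 w'.2‖ₑ ^ (3 : ℕ) =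
        ∫⁻ t in Ioo (-1 : ℝ) 0, ∫⁻ y in ball (0 : (EuclideanSpace ℝ (Fin 3))) 3, ‖w t y‖ₑ ^ (3 : ℕ) := by
      rw [Measure.volume_eq_prod, ← Measure.prod_restrict, lintegral_prod _ hmeas]
    have hsub3 : Ioo (-1 : ℝ) 0 ×ˢ ball (0 : (EuclideanSpace ℝ (Fin 3))) 3 ⊆ parabolicCylinder 3 (0 : ℝ × (EuclideanSpace ℝ (Fin 3))) := by
      intro w' hw'
      rw [mem_parabolicCylinder]
      refine ⟨⟨?_, ?_⟩, ?_⟩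
      · have := hw'.1.1; simp only [Prod.fst_zero]; linarith
      · have := hw'.1.2; simpa using this
      · simpa using hw'.2
    have e2 : ENNReal.ofReal 3 ^ 2 * cknC 3 (0 : ℝ × (EuclideanSpace ℝ (Fin 3))) w =
        ∫⁻ w' in parabolicCylinder 3 (0 : ℝ × (EuclideanSpace ℝ (Fin 3))), ‖w w'.1 w'.2‖ₑ ^ (3 : ℕ) := by
      unfold cknC
      rw [← mul_assoc, ENNReal.mul_inv_cancel (pow_ne_zero _ (by norm_num))
        (ENNReal.pow_ne_top ENNReal.ofReal_ne_top), one_mul]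
    rw [← e1, e2]
    exact lintegral_mono_set hsub3
  -- integrate in time
  calc ∫⁻ t in Ioo (-1 : ℝ) 0, ∫⁻ x in ball (0 : (EuclideanSpace ℝ (Fin 3))) 1, ‖q t x - m t‖ₑ ^ (3 / 2 : ℝ)
      ≤ ∫⁻ t in Ioo (-1 : ℝ) 0, (K₁ * (∫⁻ y in ball (0 : (EuclideanSpace ℝ (Fin 3))) 3, ‖w t y‖ₑ ^ (3 : ℕ)) +
          K₂ * ENNReal.ofReal M ^ (3 / 2 : ℝ)) := setLIntegral_mono' measurableSet_Ioo hslice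
    _ = K₁ * (∫⁻ t in Ioo (-1 : ℝ) 0, ∫⁻ y in ball (0 : (EuclideanSpace ℝ (Fin 3))) 3, ‖w t y‖ₑ ^ (3 : ℕ)) +
          K₂ * ENNReal.ofReal M ^ (3 / 2 : ℝ) * volume (Ioo (-1 : ℝ) 0) := by
        rw [lintegral_add_right _ measurable_const, setLIntegral_const, lintegral_const_mul' _ _ hK₁t]
    _ ≤ K₁ * (ENNReal.ofReal 3 ^ 2 * cknC 3 (0 : ℝ × (EuclideanSpace ℝ (Fin 3))) w) +
          K₂ * ENNReal.ofReal M ^ (3 / 2 : ℝ) * 1 := by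
        gcongr
        rw [Real.volume_Ioo]; norm_num
    _ = _ := by rw [mul_one]

/-- **Registered sub-goal `stub_morreyZoomSetting` of stub Z5** (= `zoom_setting`, stated with the
notions written out): the Navier–Stokes zoom about a past point preserves the Morrey setting (classical
on `(-∞,0)`, same Morrey constant, bound `cV`).
[cite: KochNadirashviliSereginSverak2009, §1 (1.2) (arXiv:0709.3599 p. 2)] -/
theorem stub_morreyZoomSetting :
    ∀ (v : ℝ → EuclideanSpace ℝ (Fin 3) → EuclideanSpace ℝ (Fin 3)) (P : ℝ → EuclideanSpace ℝ
      (Fin 3) → ℝ) (M V : ℝ), Literature.Analysis.FluidPDE.IsClassicalNSSolutionOn (Set.Iio 0) 1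
      0 v P → (∀ t < 0, ∀ (y : EuclideanSpace ℝ (Fin 3)) (r : ℝ), 0 < r → ∫ x in Metric.ball y r,
      ‖v t x‖ ^ 2 ≤ M * r) → (∀ t < 0, ∀ x, ‖v t x‖ ≤ V) → ∀ (c : ℝ), 0 < c → ∀ (t₀ : ℝ), t₀ ≤ 0
      → ∀ (x₀ : EuclideanSpace ℝ (Fin 3)), Literature.Analysis.FluidPDE.IsClassicalNSSolutionOn
      (Set.Iio 0) 1 0 (c • Literature.Analysis.FluidPDE.stPull (c ^ 2) c t₀ x₀ v) (c ^ 2 •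
      Literature.Analysis.FluidPDE.stPull (c ^ 2) c t₀ x₀ P) ∧ (∀ s < 0, ∀ (y : EuclideanSpace ℝ
      (Fin 3)) (r : ℝ), 0 < r → ∫ y' in Metric.ball y r, ‖(c •
      Literature.Analysis.FluidPDE.stPull (c ^ 2) c t₀ x₀ v) s y'‖ ^ 2 ≤ M * r) ∧ (∀ s < 0, ∀ y,
      ‖(c • Literature.Analysis.FluidPDE.stPull (c ^ 2) c t₀ x₀ v) s y‖ ≤ c * V) :=
  fun _ _ _ _ hcl hMor hbd _ hc _ ht₀ x₀ => zoom_setting hcl hMor hbd hc ht₀ x₀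

end Summit.NavierStokesRegularity.NavierStokesRegularity.Theorems.BoundedEnvelope

end
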